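import Summits.ValiantsHypothesis.ValiantsHypothesis.Theorems.BarrierLeverAnchoredDoorHitsLowerPairsApexLemma
import Mathlib.Algebra.MvPolynomial.Funext
import Mathlib.LinearAlgebra.Matrix.ToLinearEquiv

/-!
# Support item `AnchoredDoorHitsLowerPairs` (stmt-ValiantsHypothesis-22510), line `anchored-peeling`:
# THE APEX RECURSION — apex-decomposable column families satisfy Conjecture M (generic doors), and the one-stub composition with the «apex rest»

Helper file (`--supports stmt-ValiantsHypothesis-22510`; cell valiant-natproofs, rung V4, 𝒟-side door (c); registered line
`Cruxes/AnchoredDoorHitsLowerPairs/Lines/anchored_peeling.lean` v16/v17; prover seat val-np-p1 gen 21; memo HOME/val-np-p1/g21/MEMO-conjM-LT-valnp1-g21.md §6–§8).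
Closes NO item.

GENERIC PACKAGING (§1–§2). Symbolic doors `doorElemS` with coefficients in the parameter ring `ℂ[Θ, Φ]` (`DoorParam h`) evaluate to `doorElem` (`map_eval_doorElemS`);
for a full-size family (`#F = 2^{#X}`) the symbolic determinant `detS` evaluates to the door determinant, and `IndepCols X F θ φ ↔ det ≠ 0`
(`indepCols_iff_det_ne_zero`); hence two full-size families that are each independent for SOME doors are SIMULTANEOUSLY independent for some doors
(`exists_indepCols_and`, via `MvPolynomial.funext` and the product of the two symbolic determinants in the domain `ℂ[Θ, Φ]`).

THE RECURSION (§3). `ApexDecomp X F` (inductive): `{∅}` on `X = ∅`; and `F` on `X' ⊔ n` whenever some apex `v⋆`, tail set `G₁` and lifted set `T` satisfy the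
hypotheses of the Apex Lemma with both halves `F' ∖ T`, `L ∪ T` apex-decomposable on `X'`. **THEOREM `exists_indepCols_of_apexDecomp`: every apex-decomposable
family has independent door columns for some doors** (Apex Lemma + generic packaging + `ApexDecomp.card`). Consequences: `conjM_det_ne_zero_of_apexDecomp`
(the instance of Conjecture M for a pair whose rows are the cube `2^X` and whose column family is apex-decomposable), `symbolicDet_one_ne_zero_of_apexDecomp`
(such pairs are hit at profile 1).

THE ONE-STUB COMPOSITION (§4). `Stmt.stub_apexRest` — the face-UQ residual minus the pairs in which one side is a full cube `2^X` and the other side's column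
family is apex-decomposable over `X` (census, memo §7: every dominated complex at `|X| ≤ 4`, 99.6 % at `|X| = 5, 6`, all balls) — and
`anchoredDoorHitsLowerPairs_of_apexRest : Stmt.stub_apexRest → AnchoredDoorHitsLowerPairs` (route decl BY NAME; no conjecture left besides the rest).

WHAT THIS IS NOT: `Stmt.stub_apexRest` is OPEN (census-empty); nothing on crux stmt-ValiantsHypothesis-14610 or on `VP` versus `VNP`.
-/

set_option linter.dupNamespace false

namespace Summit.ValiantsHypothesis.ValiantsHypothesis.Theorems.BarrierLever.AnchoredPeeling

open Finset MvPolynomial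
open Summit.ValiantsHypothesis.ValiantsHypothesis.Theorems.BarrierLever.BrickCalculus (pexpo pexpo_def pexpo_le_iff pexpo_sub
  pexpo_apply_castAdd pexpo_apply_natAdd)

noncomputable section

variable {h : ℕ}

/-! ## 1. Symbolic doors -/

/-- Door parameter indices: root weights `Θ (b, γ)` and tail weights `Φ (b, γ, b')`. -/
abbrev DoorParam (h : ℕ) : Type := (Fin h × Fin h) ⊕ (Fin h × Fin h × Fin h)

/-- The root weights of a parameter point. -/
def thetaOf (p : DoorParam h → ℂ) : Fin h → Fin h → ℂ := fun b γ => p (Sum.inl (b, γ))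

/-- The tail weights of a parameter point. -/
def phiOf (p : DoorParam h → ℂ) : Fin h → Fin h → Fin h → ℂ := fun b γ b' => p (Sum.inr (b, γ, b'))

/-- The parameter point of a pair `(θ, φ)`. -/
def pointOf (θ : Fin h → Fin h → ℂ) (φ : Fin h → Fin h → Fin h → ℂ) : DoorParam h → ℂ
  | Sum.inl q => θ q.1 q.2
  | Sum.inr q => φ q.1 q.2.1 q.2.2

/-- The root weights of `pointOf θ φ` are `θ`. -/
@[simp] theorem thetaOf_pointOf (θ : Fin h → Fin h → ℂ) (φ : Fin h → Fin h → Fin h → ℂ) : thetaOf (pointOf θ φ) = θ := rfl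

/-- The tail weights of `pointOf θ φ` are `φ`. -/
@[simp] theorem phiOf_pointOf (θ : Fin h → Fin h → ℂ) (φ : Fin h → Fin h → Fin h → ℂ) : phiOf (pointOf θ φ) = φ := rfl

/-- The symbolic door of the vertex `γ`, coefficients in `ℂ[Θ, Φ]`. -/
def doorElemS (γ : Fin h) : MvPolynomial (Fin (h + h)) (MvPolynomial (DoorParam h) ℂ) :=
  ∑ b : Fin h, monomial (pexpo {b} ∅) 1 *
    (C (X (Sum.inl (b, γ))) * ∏ b' ∈ univ \ {b}, (1 + C (X (Sum.inr (b, γ, b'))) * X (Fin.castAdd h b')))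

/-- **Evaluating the symbolic door gives the door.** -/
theorem map_eval_doorElemS (p : DoorParam h → ℂ) (γ : Fin h) :
    MvPolynomial.map (eval p) (doorElemS γ) = doorElem (thetaOf p) (phiOf p) γ := by
  rw [doorElemS, doorElem, map_sum]
  refine Finset.sum_congr rfl (fun b _ => ?_)
  rw [cfacCore, map_mul, map_monomial, map_one, map_mul, map_C, eval_X, map_prod]
  congr 2
  refine Finset.prod_congr rfl (fun b' _ => ?_)
  rw [map_add, map_one, map_mul, map_C, eval_X, map_X]
  rfl

/-- Evaluating a product of symbolic doors. -/
theorem map_eval_prod_doorElemS (p : DoorParam h → ℂ) (W : Finset (Fin h)) :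
    MvPolynomial.map (eval p) (∏ γ ∈ W, doorElemS γ) = ∏ γ ∈ W, doorElem (thetaOf p) (phiOf p) γ := by
  rw [map_prod]
  exact Finset.prod_congr rfl (fun γ _ => map_eval_doorElemS p γ)

/-! ## 2. Full-size families: independence is a determinant, hence generic -/

section Det

variable (X : Finset (Fin h)) (F : Finset (Finset (Fin h)))

/-- The door matrix of `F` on the rows `2^X`, columns enumerated by `e`. -/
def doorMat (e : ↥X.powerset ≃ ↥F) (θ : Fin h → Fin h → ℂ) (φ : Fin h → Fin h → Fin h → ℂ) :
    Matrix ↥X.powerset ↥X.powerset ℂ :=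
  Matrix.of fun U V => coeff (pexpo U.1 ∅) (∏ γ ∈ (e V).1, doorElem θ φ γ)

/-- Its symbolic version. -/
def doorMatS (e : ↥X.powerset ≃ ↥F) : Matrix ↥X.powerset ↥X.powerset (MvPolynomial (DoorParam h) ℂ) :=
  Matrix.of fun U V => coeff (pexpo U.1 ∅) (∏ γ ∈ (e V).1, doorElemS γ)

variable {X F}

/-- The symbolic determinant evaluates to the determinant. -/
theorem eval_det_doorMatS (e : ↥X.powerset ≃ ↥F) (p : DoorParam h → ℂ) :
    eval p (doorMatS X F e).det = (doorMat X F e (thetaOf p) (phiOf p)).det := by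
  rw [RingHom.map_det]
  congr 1
  ext U V
  rw [RingHom.mapMatrix_apply, Matrix.map_apply, doorMatS, doorMat, Matrix.of_apply, Matrix.of_apply, ← coeff_map, map_eval_prod_doorElemS]

/-- **For a full-size family, column independence is nonvanishing of the door determinant.** -/
theorem indepCols_iff_det_ne_zero (e : ↥X.powerset ≃ ↥F) (θ : Fin h → Fin h → ℂ) (φ : Fin h → Fin h → Fin h → ℂ) :
    IndepCols X F θ φ ↔ (doorMat X F e θ φ).det ≠ 0 := by
  classical
  constructor
  · intro hind hdet
    obtain ⟨v, hv, hMv⟩ := Matrix.exists_mulVec_eq_zero_iff.mpr hdet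
    apply hv
    -- the combination with coefficients g W = v (e⁻¹ W) vanishes
    set g : Finset (Fin h) → ℂ := fun W => if hW : W ∈ F then v (e.symm ⟨W, hW⟩) else 0 with hg
    have hcomb : ∀ U : Finset (Fin h), U ⊆ X → ∑ W ∈ F, g W * coeff (pexpo U ∅) (∏ γ ∈ W, doorElem θ φ γ) = 0 := by
      intro U hU
      have hrow := congrFun hMv ⟨U, Finset.mem_powerset.mpr hU⟩
      rw [Pi.zero_apply, Matrix.mulVec, dotProduct] at hrow
      rw [← Finset.sum_coe_sort F, ← hrow, ← e.sum_comp]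
      refine Finset.sum_congr rfl (fun V _ => ?_)
      rw [doorMat, Matrix.of_apply, hg]
      simp only [Finset.coe_mem, dite_true, Subtype.coe_eta, Equiv.symm_apply_apply]
      ring
    funext V
    have := hind g hcomb (e V).1 (e V).2
    rw [hg] at this
    simp only [Finset.coe_mem, dite_true, Subtype.coe_eta, Equiv.symm_apply_apply] at this
    exact this
  · intro hdet g hg W hW
    set v : ↥X.powerset → ℂ := fun V => g (e V).1 with hv
    have hMv : (doorMat X F e θ φ).mulVec v = 0 := by
      funext U
      rw [Pi.zero_apply, Matrix.mulVec, dotProduct]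
      have := hg U.1 (Finset.mem_powerset.mp U.2)
      rw [← Finset.sum_coe_sort F, ← e.sum_comp] at this
      rw [← this]
      refine Finset.sum_congr rfl (fun V _ => ?_)
      rw [doorMat, Matrix.of_apply, hv, mul_comm]
    have hv0 : v = 0 := by
      by_contra hne
      exact hdet (Matrix.exists_mulVec_eq_zero_iff.mp ⟨v, hne, hMv⟩)
    have := congrFun hv0 (e.symm ⟨W, hW⟩)
    simp only [hv, Pi.zero_apply, Equiv.apply_symm_apply] at this
    exact this

/-- A full-size family has a column enumeration by the rows. -/
theorem exists_equiv_of_card (hcard : F.card = 2 ^ X.card) : Nonempty (↥X.powerset ≃ ↥F) := by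
  refine ⟨Fintype.equivOfCardEq ?_⟩
  rw [Fintype.card_coe, Fintype.card_coe, Finset.card_powerset, hcard]

/-- **Generic simultaneity.** Two full-size families that are each independent for some doors are independent for common doors. -/
theorem exists_indepCols_and {X : Finset (Fin h)} {F₀ F₁ : Finset (Finset (Fin h))} (h0c : F₀.card = 2 ^ X.card) (h1c : F₁.card = 2 ^ X.card)
    (h0 : ∃ θ φ, IndepCols X F₀ θ φ) (h1 : ∃ θ φ, IndepCols X F₁ θ φ) :
    ∃ (θ : Fin h → Fin h → ℂ) (φ : Fin h → Fin h → Fin h → ℂ), IndepCols X F₀ θ φ ∧ IndepCols X F₁ θ φ := by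
  obtain ⟨e₀⟩ := exists_equiv_of_card h0c
  obtain ⟨e₁⟩ := exists_equiv_of_card h1c
  obtain ⟨θ₀, φ₀, hI₀⟩ := h0
  obtain ⟨θ₁, φ₁, hI₁⟩ := h1
  have hQ₀ : (doorMatS X F₀ e₀).det ≠ 0 := by
    intro h0
    apply (indepCols_iff_det_ne_zero e₀ θ₀ φ₀).mp hI₀
    have h' := eval_det_doorMatS e₀ (pointOf θ₀ φ₀)
    rw [thetaOf_pointOf, phiOf_pointOf, h0, map_zero] at h'
    exact h'.symm
  have hQ₁ : (doorMatS X F₁ e₁).det ≠ 0 := by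
    intro h0
    apply (indepCols_iff_det_ne_zero e₁ θ₁ φ₁).mp hI₁
    have h' := eval_det_doorMatS e₁ (pointOf θ₁ φ₁)
    rw [thetaOf_pointOf, phiOf_pointOf, h0, map_zero] at h'
    exact h'.symm
  have hprod : (doorMatS X F₀ e₀).det * (doorMatS X F₁ e₁).det ≠ 0 := mul_ne_zero hQ₀ hQ₁
  -- a non-root of the product
  have hpt : ∃ p : DoorParam h → ℂ, eval p ((doorMatS X F₀ e₀).det * (doorMatS X F₁ e₁).det) ≠ 0 := by
    by_contra hall
    exact hprod (MvPolynomial.funext (fun p => by rw [map_zero]; exact not_not.mp (fun hne => hall ⟨p, hne⟩)))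
  obtain ⟨p, hp⟩ := hpt
  rw [map_mul] at hp
  refine ⟨thetaOf p, phiOf p, ?_, ?_⟩
  · exact (indepCols_iff_det_ne_zero e₀ _ _).mpr (by rw [← eval_det_doorMatS]; exact left_ne_zero_of_mul hp)
  · exact (indepCols_iff_det_ne_zero e₁ _ _).mpr (by rw [← eval_det_doorMatS]; exact right_ne_zero_of_mul hp)

end Det

/-! ## 3. Truncation at the new variable, the recursion, and the main theorem -/

/-- Truncated root weights: no root at `n`. -/
def truncTheta (n : Fin h) (θ : Fin h → Fin h → ℂ) : Fin h → Fin h → ℂ := fun b γ => if b = n then 0 else θ b γ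

/-- Truncated tail weights: no tail at `n`. -/
def truncPhi (n : Fin h) (φ : Fin h → Fin h → Fin h → ℂ) : Fin h → Fin h → Fin h → ℂ := fun b γ b' => if b' = n then 0 else φ b γ b'

/-- Killing `x_n` in a door truncates its parameters. -/
theorem killVars_doorElem (n : Fin h) (θ : Fin h → Fin h → ℂ) (φ : Fin h → Fin h → Fin h → ℂ) (γ : Fin h) :
    ThinStep.killVars {Fin.castAdd h n} (doorElem θ φ γ) = doorElem (truncTheta n θ) (truncPhi n φ) γ := by
  classical
  rw [doorElem, doorElem, map_sum]
  refine Finset.sum_congr rfl (fun b _ => ?_)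
  rw [cfacCore, cfacCore, map_mul, map_mul, map_prod, ThinStep.killVars_C, pexpo_singleton_empty, ← X, ThinStep.killVars_X]
  by_cases hb : b = n
  · subst hb
    simp only [Finset.mem_singleton, if_true, truncTheta, zero_mul, C_0, mul_zero]
  · rw [if_neg (fun hmem => hb (Fin.castAdd_inj.mp (Finset.mem_singleton.mp hmem)))]
    simp only [truncTheta, if_neg hb]
    congr 2
    refine Finset.prod_congr rfl (fun b' _ => ?_)
    rw [map_add, map_one, map_mul, ThinStep.killVars_C, ThinStep.killVars_X]
    by_cases hb' : b' = n
    · subst hb'; simp [truncPhi]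
    · rw [if_neg (fun hmem => hb' (Fin.castAdd_inj.mp (Finset.mem_singleton.mp hmem)))]
      simp only [truncPhi, if_neg hb']

/-- **Rows avoiding `n` do not see the parameters at `n`.** -/
theorem indepCols_trunc_iff {X' : Finset (Fin h)} {n : Fin h} (hn : n ∉ X') (F : Finset (Finset (Fin h))) (θ : Fin h → Fin h → ℂ)
    (φ : Fin h → Fin h → Fin h → ℂ) : IndepCols X' F (truncTheta n θ) (truncPhi n φ) ↔ IndepCols X' F θ φ := by
  classical
  have hentry : ∀ U, U ⊆ X' → ∀ W : Finset (Fin h),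
      coeff (pexpo U ∅) (∏ γ ∈ W, doorElem (truncTheta n θ) (truncPhi n φ) γ) = coeff (pexpo U ∅) (∏ γ ∈ W, doorElem θ φ γ) := by
    intro U hU W
    have hkill : (∏ γ ∈ W, doorElem (truncTheta n θ) (truncPhi n φ) γ) = ThinStep.killVars {Fin.castAdd h n} (∏ γ ∈ W, doorElem θ φ γ) := by
      rw [map_prod]; exact Finset.prod_congr rfl (fun γ _ => (killVars_doorElem n θ φ γ).symm)
    rw [hkill, ThinStep.coeff_killVars_of_disjoint]
    rw [Finset.disjoint_singleton_right, castAdd_mem_support_pexpo_iff]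
    exact fun hmem => hn (hU hmem)
  constructor <;> intro hI g hg
  · exact hI g (fun U hU => by rw [Finset.sum_congr rfl (fun W _ => by rw [hentry U hU W])]; exact hg U hU)
  · exact hI g (fun U hU => by rw [Finset.sum_congr rfl (fun W _ => by rw [← hentry U hU W])]; exact hg U hU)

/-- **Apex-decomposable column families** (memo §6): `{∅}` over no variables, or split by an apex vertex `v⋆ ↦ x_n` and a tail set `G₁` into two
apex-decomposable halves one variable down. -/
inductive ApexDecomp : Finset (Fin h) → Finset (Finset (Fin h)) → Prop
  | base : ApexDecomp ∅ {∅}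
  | step {X' : Finset (Fin h)} {n vs : Fin h} {F : Finset (Finset (Fin h))} {G₁ : Finset (Fin h)} {T : Finset (Finset (Fin h))}
      (hn : n ∉ X')
      (hTF : ∀ Y ∈ T, Y ∈ F ∧ vs ∉ Y) (hTG : ∀ Y ∈ T, (∑ γ ∈ Y, tailInd G₁ γ) ≠ 0) (hTL : ∀ Y ∈ T, insert vs Y ∉ F)
      (hcov : ∀ Y ∈ F, vs ∉ Y → (∑ γ ∈ Y, tailInd G₁ γ) ≠ 0 → Y ∈ T ∨ insert vs Y ∈ F)
      (h0 : ApexDecomp X' ((F.filter (fun W => vs ∉ W)) \ T))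
      (h1 : ApexDecomp X' (((F.filter (fun W => vs ∈ W)).image (fun W => W.erase vs)) ∪ T)) :
      ApexDecomp (insert n X') F

/-- Apex-decomposable families are full-size. -/
theorem ApexDecomp.card_eq {X : Finset (Fin h)} {F : Finset (Finset (Fin h))} (hF : ApexDecomp X F) : F.card = 2 ^ X.card := by
  classical
  induction hF with
  | base => simp
  | @step X' n vs F G₁ T hn hTF hTG hTL hcov h0 h1 ih0 ih1 =>
    rw [Finset.card_insert_of_notMem hn, pow_succ]
    set F' := F.filter (fun W => vs ∉ W) with hF'
    set Fp := F.filter (fun W => vs ∈ W) with hFp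
    set L := Fp.image (fun W => W.erase vs) with hL
    have hTsub : T ⊆ F' := fun Y hY => Finset.mem_filter.mpr (hTF Y hY)
    have hTL' : Disjoint L T := by
      rw [Finset.disjoint_left]
      intro Y hYL hYT
      obtain ⟨W, hW, rfl⟩ := Finset.mem_image.mp hYL
      have hvs : vs ∈ W := (Finset.mem_filter.mp hW).2
      exact hTL _ hYT (by rw [Finset.insert_erase hvs]; exact (Finset.mem_filter.mp hW).1)
    have hLcard : L.card = Fp.card := by
      rw [hL]
      refine Finset.card_image_of_injOn (fun W hW W' hW' heq => ?_)
      have h1' : vs ∈ W := (Finset.mem_filter.mp hW).2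
      have h2' : vs ∈ W' := (Finset.mem_filter.mp hW').2
      have heq' : W.erase vs = W'.erase vs := heq
      rw [← Finset.insert_erase h1', ← Finset.insert_erase h2', heq']
    have hsplit : F.card = F'.card + Fp.card := by
      rw [hF', hFp, ← Finset.card_filter_add_card_filter_not (fun W => vs ∉ W)]
      congr 1
      exact congrArg Finset.card (Finset.filter_congr (fun W _ => by rw [not_not]))
    have h0c : (F' \ T).card = F'.card - T.card := Finset.card_sdiff_of_subset hTsub
    have h1c : (L ∪ T).card = L.card + T.card := Finset.card_union_of_disjoint hTL'
    have hTle : T.card ≤ F'.card := Finset.card_le_card hTsub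
    rw [hsplit, ← hLcard]
    omega

/-- **MAIN THEOREM: apex-decomposable families have independent door columns for some doors.** -/
theorem exists_indepCols_of_apexDecomp {X : Finset (Fin h)} {F : Finset (Finset (Fin h))} (hF : ApexDecomp X F) :
    ∃ (θ : Fin h → Fin h → ℂ) (φ : Fin h → Fin h → Fin h → ℂ), IndepCols X F θ φ := by
  classical
  induction hF with
  | base =>
    refine ⟨fun _ _ => 0, fun _ _ _ => 0, fun g hg W hW => ?_⟩
    rw [Finset.mem_singleton] at hW
    subst hW
    have := hg ∅ (Finset.empty_subset _)
    rw [Finset.sum_singleton, Finset.prod_empty, MvPolynomial.coeff_one, if_pos (by simp [pexpo_def]), mul_one] at this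
    exact this
  | @step X' n vs F G₁ T hn hTF hTG hTL hcov h0 h1 ih0 ih1 =>
    obtain ⟨θ, φ, hI0, hI1⟩ := exists_indepCols_and h0.card_eq h1.card_eq ih0 ih1
    refine ⟨apexTheta (truncTheta n θ) vs n, apexPhi (truncPhi n φ) vs n G₁, ?_⟩
    exact indepCols_apex hn F G₁ T hTF hTG hTL hcov (fun γ => by simp [truncTheta]) (fun b γ => by simp [truncPhi])
      ((indepCols_trunc_iff hn _ θ φ).mpr hI0) ((indepCols_trunc_iff hn _ θ φ).mpr hI1)

/-! ## 4. The instance of Conjecture M, the profile-1 hit, and the one-stub composition -/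

/-- **Independent columns ⟹ nonzero door determinant on any square layout** whose rows exhaust `2^X` and whose columns are drawn injectively from `F`. -/
theorem det_ne_zero_of_indepCols {X : Finset (Fin h)} {F : Finset (Finset (Fin h))} {θ : Fin h → Fin h → ℂ} {φ : Fin h → Fin h → Fin h → ℂ}
    (hI : IndepCols X F θ φ) {r : ℕ} (u w : Fin r → Finset (Fin h)) (hu : ∀ U, U ⊆ X → ∃ i, u i = U) (hw : Function.Injective w)
    (hwF : ∀ j, w j ∈ F) :
    (Matrix.of fun i j : Fin r => coeff (pexpo (u i) ∅) (∏ γ ∈ w j, doorElem θ φ γ)).det ≠ 0 := by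
  classical
  intro hdet
  obtain ⟨v, hv, hMv⟩ := Matrix.exists_mulVec_eq_zero_iff.mpr hdet
  apply hv
  set g : Finset (Fin h) → ℂ := fun W => if hW : ∃ j, w j = W then v hW.choose else 0 with hg
  have hgw : ∀ j, g (w j) = v j := by
    intro j
    have hex : ∃ j', w j' = w j := ⟨j, rfl⟩
    rw [hg]; simp only [dif_pos hex]
    exact congrArg v (hw hex.choose_spec)
  have hcomb : ∀ U, U ⊆ X → ∑ W ∈ F, g W * coeff (pexpo U ∅) (∏ γ ∈ W, doorElem θ φ γ) = 0 := by
    intro U hU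
    obtain ⟨i, rfl⟩ := hu U hU
    have hrow := congrFun hMv i
    rw [Pi.zero_apply, Matrix.mulVec, dotProduct] at hrow
    -- the sum over F restricts to the image of w
    have hzero : ∀ W ∈ F, W ∉ Finset.univ.image w → g W * coeff (pexpo (u i) ∅) (∏ γ ∈ W, doorElem θ φ γ) = 0 := by
      intro W _ hW
      have hne : ¬ ∃ j, w j = W := fun ⟨j, hj⟩ => hW (Finset.mem_image.mpr ⟨j, Finset.mem_univ j, hj⟩)
      rw [hg]; simp only [dif_neg hne, zero_mul]
    rw [← Finset.sum_subset (fun W hW => by obtain ⟨j, -, rfl⟩ := Finset.mem_image.mp hW; exact hwF j) hzero,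
      Finset.sum_image (fun j _ j' _ hjj => hw hjj), ← hrow]
    refine Finset.sum_congr rfl (fun j _ => ?_)
    rw [hgw, Matrix.of_apply, mul_comm]
  funext j
  rw [Pi.zero_apply, ← hgw]
  exact hI g hcomb (w j) (hwF j)

/-- **The instance of Conjecture M for a cube-row pair whose column family is apex-decomposable.** -/
theorem conjM_det_ne_zero_of_apexDecomp {X : Finset (Fin h)} {r : ℕ} (u w : Fin r → Finset (Fin h)) (hu : ∀ U, U ⊆ X → ∃ i, u i = U)
    (hw : Function.Injective w) (hF : ApexDecomp X (Finset.univ.image w)) :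
    ∃ (θ : Fin h → Fin h → ℂ) (φ : Fin h → Fin h → Fin h → ℂ),
      (Matrix.of fun i j : Fin r => coeff (pexpo (u i) ∅) (∏ γ ∈ w j, doorElem θ φ γ)).det ≠ 0 := by
  obtain ⟨θ, φ, hI⟩ := exists_indepCols_of_apexDecomp hF
  exact ⟨θ, φ, det_ne_zero_of_indepCols hI u w hu hw (fun j => Finset.mem_image.mpr ⟨j, Finset.mem_univ j, rfl⟩)⟩

/-- **Such pairs are hit at profile 1** (the `ψ = 0` member, as in `symbolicDet_one_ne_zero_of_conjM`). -/
theorem symbolicDet_one_ne_zero_of_apexDecomp {X : Finset (Fin h)} {r : ℕ} (u w : Fin r → Finset (Fin h)) (hu : ∀ U, U ⊆ X → ∃ i, u i = U)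
    (hw : Function.Injective w) (hF : ApexDecomp X (Finset.univ.image w)) : symbolicDet 1 h r u w ≠ 0 := by
  classical
  obtain ⟨θ, φ, hdet⟩ := conjM_det_ne_zero_of_apexDecomp u w hu hw hF
  intro h0
  have hmap := congrArg (eval (mPoint θ φ)) h0
  rw [map_zero, symbolicDet, RingHom.map_det] at hmap
  apply hdet
  rw [← hmap]
  congr 1
  refine Matrix.ext (fun i j => ?_)
  rw [RingHom.mapMatrix_apply, Matrix.map_apply, Matrix.of_apply, Matrix.of_apply, ← pexpo_def, ← coeff_map, map_mPoint_symbolicWitness,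
    coeff_prod_cpart θ φ Finset.univ (u i) (w j) (Finset.subset_univ _)]

/-- A pair is an **apex pair** if its rows exhaust a cube `2^X` and its column family is apex-decomposable over `X`. -/
def IsApexPair {r : ℕ} (u w : Fin r → Finset (Fin h)) : Prop :=
  ∃ X : Finset (Fin h), (∀ U, U ⊆ X → ∃ i, u i = U) ∧ ApexDecomp X (Finset.univ.image w)

/-- **STUB TEXT (offered): THE APEX REST.** At some fixed profile `s ≥ 1` and all `h ≥ h₀`: every injective simplicial-complex pair with `r ≥ 2` rows, NO face-UQ
data on either side, which is not an apex pair in either orientation, has nonzero symbolic minor. (Census-empty: memo §7.) -/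
def Stmt.stub_apexRest : Prop :=
  ∃ s h₀ : ℕ, 1 ≤ s ∧ ∀ h : ℕ, h₀ ≤ h → ∀ (r : ℕ) (u w : Fin r → Finset (Fin h)),
    Function.Injective u → Function.Injective w → IsLowerSet (Set.range u) → IsLowerSet (Set.range w) → 2 ≤ r →
    (∀ (a : Fin h) (W₀ : Finset (Fin h)) (𝒜 : Finset (Finset (Fin h))) (ρ : Finset (Fin h) → Finset (Fin h)), ¬ UQFData s u w a W₀ 𝒜 ρ) →
    (∀ (c : Fin h) (Z : Finset (Fin h)) (𝒜 : Finset (Finset (Fin h))) (ρ : Finset (Fin h) → Finset (Fin h)), ¬ UQFData s w u c Z 𝒜 ρ) →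
    ¬ IsApexPair u w → ¬ IsApexPair w u →
    symbolicDet s h r u w ≠ 0

/-- **The merger (kernel-checked, NO conjecture on the apex side): apex rest ⟹ the registered residual `Stmt.stub_uqFaceResidual`.** -/
theorem stub_uqFaceResidual_of_apexRest (hR : Stmt.stub_apexRest) : Stmt.stub_uqFaceResidual := by
  obtain ⟨s, h₀, hs, hR⟩ := hR
  refine ⟨s, h₀, hs, fun h hh r u w hu hw hlu hlw hr hx hy => ?_⟩
  by_cases hdx : IsApexPair u w
  · obtain ⟨X, huX, hF⟩ := hdx
    exact symbolicDet_ne_zero_mono hs (symbolicDet_one_ne_zero_of_apexDecomp u w huX hw hF)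
  · by_cases hdy : IsApexPair w u
    · obtain ⟨X, hwX, hF⟩ := hdy
      exact (symbolicDet_ne_zero_comm s h r u w).mpr (symbolicDet_ne_zero_mono hs (symbolicDet_one_ne_zero_of_apexDecomp w u hwX hu hF))
    · exact hR h hh r u w hu hw hlu hlw hr hx hy hdx hdy

/-- **Composition BY NAME: apex rest ⟹ the support item `AnchoredDoorHitsLowerPairs`** (with the landed `stub_uqFaceStep`). -/
theorem anchoredDoorHitsLowerPairs_of_apexRest (hR : Stmt.stub_apexRest) :
    Summit.ValiantsHypothesis.ValiantsHypothesis.Theses.BarrierLever.AnchoredDoorHitsLowerPairs := by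
  obtain ⟨s, h₀, K⟩ := anchoredHit_of_uqFace stub_uqFaceStep (stub_uqFaceResidual_of_apexRest hR)
  exact ⟨s, h₀, fun h hh r u w hu hw hlu hlw => K h hh r u w hu hw hlu hlw⟩

end

end Summit.ValiantsHypothesis.ValiantsHypothesis.Theorems.BarrierLever.AnchoredPeeling
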